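import Summits.ValiantsHypothesis.ValiantsHypothesis.Theorems.NcRotParseTree
import HarnessLib

/-!
# Rotation-UPT circuits: rank accounting on interval flattenings over a rotation span

Helper file 2/3 of the rotation-UPT rung (restricted-models ladder of `CommutativityDial`; item
`PerNotNcVP` untouched; pure linear algebra over a field, no complexity statement). MODEL (of
the rung, files 1 and 3): rotUPT = rotation-UPT NORMAL FORM: circuits typed by a shape T in
which every product gate multiplies an operand typed by its left child and one typed by its
right child IN EITHER ORDER (GateRot = LLS18 Prop 7 typing + the rotated product); the
conversion of an arbitrary rotUPT circuit (LLS18 §4: all parse trees rotations of one tree) to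
this normal form (gate duplication per node, poly blow-up) is NOT formalised. For the interval
flattening `ivFlat K a ℓ b` (rows = contexts `(y₁, y₂)` outside the middle block `[a, a+ℓ)`,
columns = its content) and a member `f` of a rotation span `rotSpan B d F` (`NcRotParseTree`)
whose bodies have degree `m` and lie among `vals`, three accounting lemmas bound
`rank (ivFlat f)` linearly in `|vals|` (`N = |σ|`): COVER `rank_ivFlat_cover_le` (every framed
block covers the middle; rows are multiples of `(m-ℓ+1) N^{m-ℓ}` overhang rows `bodyMat`,
pattern of `NcUnbalancedRank.rank_outerFlat_unb_le`), INSIDE `rank_ivFlat_inside_le` (blocks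
inside the middle; rows lie in the span of `(ℓ-m+1) N^{ℓ-m}` indicator-times-body rows
`insRow`), OUTSIDE-RIGHT `rank_ivFlat_outside_le` (blocks right of the middle; columns lie in
the span of `N^a (b-m+1) N^{b-m}` indicator-times-body columns `outCol`). The accounting is
ours (LLS18's full-version proof of Thm 17 is not held).
[cite: LagardeLimayeSrinivasan2018, §4 Theorem 17] [cite: LagardeMalodPerifel2019, §3]
-/

noncomputable section

namespace Summit.ValiantsHypothesis.ValiantsHypothesis.Theorems.NcRotParseTreeRank

set_option linter.dupNamespace false

open Summit.ValiantsHypothesis.ValiantsHypothesis.Theorems.NcCentralWidth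
  Summit.ValiantsHypothesis.ValiantsHypothesis.Theorems.NcSOSDegreeFour
  Summit.ValiantsHypothesis.ValiantsHypothesis.Theorems.NcSkewPermanent
  Summit.ValiantsHypothesis.ValiantsHypothesis.Theorems.NcUnbalancedRank
  Summit.ValiantsHypothesis.ValiantsHypothesis.Theorems.NcUniqueParseTreeRank
  Summit.ValiantsHypothesis.ValiantsHypothesis.Theorems.NcRotParseTree

universe u v

section Lists

variable {σ : Type v}

/-- Three-block words, cut inside the left block. [folklore] -/
theorem take_drop₃_left {X Y Z : List σ} {a n : ℕ} (hX : X.length = a) (hn : n ≤ a) :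
    (X ++ Y ++ Z).take n = X.take n ∧ (X ++ Y ++ Z).drop n = X.drop n ++ Y ++ Z := by
  rw [List.take_append_of_le_length (by rw [List.length_append]; omega),
    List.take_append_of_le_length (by omega),
    List.drop_append_of_le_length (by rw [List.length_append]; omega),
    List.drop_append_of_le_length (by omega)]
  exact ⟨rfl, rfl⟩

/-- Three-block words, cut inside the middle block. [folklore] -/
theorem take_drop₃_mid {X Y Z : List σ} {a ℓ n : ℕ} (hX : X.length = a) (hY : Y.length = ℓ)
    (h1 : a ≤ n) (h2 : n ≤ a + ℓ) :
    (X ++ Y ++ Z).take n = X ++ Y.take (n - a) ∧ (X ++ Y ++ Z).drop n = Y.drop (n - a) ++ Z := by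
  rw [List.take_append_of_le_length (by rw [List.length_append]; omega), List.take_append,
    List.take_of_length_le (by omega),
    List.drop_append_of_le_length (by rw [List.length_append]; omega), List.drop_append,
    List.drop_of_length_le (by omega), List.nil_append, hX]
  exact ⟨rfl, rfl⟩

/-- Three-block words, cut inside the right block. [folklore] -/
theorem take_drop₃_right {X Y Z : List σ} {a ℓ n : ℕ} (hX : X.length = a) (hY : Y.length = ℓ)
    (h : a + ℓ ≤ n) : (X ++ Y ++ Z).take n = X ++ Y ++ Z.take (n - (a + ℓ)) ∧
      (X ++ Y ++ Z).drop n = Z.drop (n - (a + ℓ)) := by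
  rw [List.take_append, List.take_of_length_le (by rw [List.length_append]; omega),
    List.drop_append, List.drop_of_length_le (by rw [List.length_append]; omega),
    List.nil_append, List.length_append, hX, hY]
  exact ⟨rfl, rfl⟩

/-- The letters from position `p` on of the word of `f : Fin a → σ`. [folklore] -/
theorem ofFn_natAdd_drop {a p e : ℕ} (h : p + e = a) (f : Fin a → σ) :
    List.ofFn (fun i : Fin e => f (Fin.castLE h.le (Fin.natAdd p i))) = (List.ofFn f).drop p := by
  apply List.ext_getElem
  · simp only [List.length_ofFn, List.length_drop]; omega
  · intro i h₁ h₂; simp only [List.getElem_ofFn, List.getElem_drop, Fin.natAdd_mk, Fin.castLE_mk]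

/-- The first `e` letters of the word of `f : Fin b → σ`. [folklore] -/
theorem ofFn_castAdd_take {b e q : ℕ} (h : e + q = b) (f : Fin b → σ) :
    List.ofFn (fun i : Fin e => f (Fin.castLE h.le (Fin.castAdd q i))) = (List.ofFn f).take e := by
  apply List.ext_getElem
  · simp only [List.length_ofFn, List.length_take]; omega
  · intro i h₁ h₂; simp only [List.getElem_ofFn, List.getElem_take, Fin.castAdd_mk, Fin.castLE_mk]

end Lists

section Card

variable {σ : Type v} [Fintype σ]

/-- `|{(e, u, u') : e ≤ k, u ∈ σ^e, u' ∈ σ^(k-e)}| = (k+1) · N^k`. [folklore] -/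
theorem card_sigma_dict (k : ℕ) :
    Fintype.card ((e : Fin (k + 1)) × ((Fin e.val → σ) × (Fin (k - e.val) → σ))) =
      (k + 1) * Fintype.card σ ^ k := by
  rw [Fintype.card_sigma, Finset.sum_congr rfl fun (e : Fin (k + 1)) _ =>
      show Fintype.card ((Fin e.val → σ) × (Fin (k - e.val) → σ)) = Fintype.card σ ^ k by
        rw [Fintype.card_prod, Fintype.card_fun, Fintype.card_fun, Fintype.card_fin,
          Fintype.card_fin, ← pow_add, Nat.add_sub_of_le (Nat.le_of_lt_succ e.isLt)],
    Finset.sum_const, Finset.card_univ, Fintype.card_fin, smul_eq_mul]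

end Card

section Flat

variable (K : Type u) [Field K] {σ : Type v}

/-- Subadditivity of rank for interval flattenings (the general folklore form is the landed
`Literature.Barriers.Schanuel.rank_add_le_rank_add_rank`, outside this file's import cone).
[folklore] -/
theorem rank_ivFlat_add_le [Fintype σ] (a ℓ b : ℕ) (f₁ f₂ : FreeAlgebra K σ) :
    (ivFlat K a ℓ b (f₁ + f₂)).rank ≤ (ivFlat K a ℓ b f₁).rank + (ivFlat K a ℓ b f₂).rank := by
  rw [map_add]
  unfold Matrix.rank
  rw [Matrix.mulVecLin_add]
  exact (Submodule.finrank_mono (LinearMap.range_add_le _ _)).trans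
    (Submodule.finrank_add_le_finrank_add_finrank _ _)

/-- **Accounting skeleton** (pattern of `NcSkewPermanent.rank_outerFlat_le`): if the linear map
`L` sends every framed body `h · g · h̄` of the rotation span to a matrix whose rows lie in the
span of a dictionary `Φ`, then so does every member, and `rank (L f) ≤ |Φ|`. [folklore] -/
theorem rank_le_of_rotSpan {X Y ι : Type*} [Fintype X] [Fintype Y] [Fintype ι]
    (L : FreeAlgebra K σ →ₗ[K] Matrix X Y K) (Φ : ι → Y → K) {B : Set (FreeAlgebra K σ)}
    {d : ℕ} {F : Finset (ℕ × ℕ)}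
    (hgen : ∀ p ∈ F, ∀ g ∈ B, ∀ h hb : FreeAlgebra K σ, degPart d p.1 h = h →
      degPart d p.2 hb = hb → ∀ x, L (h * g * hb) x ∈ Submodule.span K (Set.range Φ))
    {f : FreeAlgebra K σ} (hf : f ∈ rotSpan B d F) : (L f).rank ≤ Fintype.card ι := by
  have hrows : ∀ x, L f x ∈ Submodule.span K (Set.range Φ) := by
    unfold rotSpan at hf
    induction hf using Submodule.span_induction with
    | mem f' hf' =>
      obtain ⟨p, hp, g, h, hb, hg, hh, hhb, rfl⟩ := hf'
      exact hgen p hp g hg h hb hh hhb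
    | zero => intro x; rw [map_zero]; exact Submodule.zero_mem _
    | add f₁ f₂ _ _ h₁ h₂ => intro x; rw [map_add]; exact Submodule.add_mem _ (h₁ x) (h₂ x)
    | smul c f₁ _ h₁ => intro x; rw [map_smul]; exact Submodule.smul_mem _ c (h₁ x)
  calc (L f).rank = Module.finrank K (Submodule.span K (Set.range (L f).row)) :=
        Matrix.rank_eq_finrank_span_row _
    _ ≤ Module.finrank K (Submodule.span K (Set.range Φ)) :=
        Submodule.finrank_mono (Submodule.span_le.2 (by rintro _ ⟨x, rfl⟩; exact hrows x))
    _ ≤ Fintype.card ι := finrank_range_le_card (R := K) Φ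

/-- Splitting a member of the rotation span along a decidable property of frames.
[cite: LagardeLimayeSrinivasan2018, §4 Theorem 17] -/
theorem rotSpan_split {B : Set (FreeAlgebra K σ)} {d : ℕ} (F : Finset (ℕ × ℕ))
    (P : ℕ × ℕ → Prop) [DecidablePred P] {f : FreeAlgebra K σ} (hf : f ∈ rotSpan B d F) :
    ∃ f₁ ∈ rotSpan B d (F.filter P), ∃ f₂ ∈ rotSpan B d (F.filter fun p => ¬ P p),
      f₁ + f₂ = f := by
  have hle : rotSpan B d F ≤ rotSpan B d (F.filter P) ⊔ rotSpan B d (F.filter fun p => ¬ P p) :=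
    Submodule.span_le.2 (by
      rintro x ⟨p, hp, g, h, hb, hg, hh, hhb, rfl⟩
      by_cases hP : P p
      · exact Submodule.mem_sup_left (Submodule.subset_span
          ⟨p, Finset.mem_filter.2 ⟨hp, hP⟩, g, h, hb, hg, hh, hhb, rfl⟩)
      · exact Submodule.mem_sup_right (Submodule.subset_span
          ⟨p, Finset.mem_filter.2 ⟨hp, hP⟩, g, h, hb, hg, hh, hhb, rfl⟩))
  exact Submodule.mem_sup.1 (hle hf)

variable [DecidableEq σ]

/-- Three-factor coefficient cut for homogeneous factors (`coeff_mul_degPart` twice).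
[folklore] -/
theorem coeff_three_cut {d p₁ m p₂ : ℕ} (hd : p₁ + m + p₂ ≤ d) (w : List σ)
    (hw : w.length = p₁ + m + p₂) {h g hb : FreeAlgebra K σ} (hh : degPart d p₁ h = h)
    (hg : degPart d m g = g) (hhb : degPart d p₂ hb = hb) :
    coeff w (h * g * hb) =
      coeff (w.take p₁) h * coeff ((w.drop p₁).take m) g * coeff (w.drop (p₁ + m)) hb := by
  have s1 := coeff_mul_degPart (d := d) (a := p₁ + m) (b := p₂) (by omega) w hw (h * g) hb
  rw [degPart_mul_of_eq hh hg (by omega), hhb] at s1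
  have s2 := coeff_mul_degPart (d := d) (a := p₁) (b := m) (by omega) (w.take (p₁ + m))
    (by rw [List.length_take, hw]; omega) h g
  rw [hh, hg, List.take_take, Nat.min_eq_left (Nat.le_add_right p₁ m), List.drop_take,
    Nat.add_sub_cancel_left] at s2
  rw [s1, s2]

/-- COVER row formula (`h` of degree `p`, body `g` of degree `e₁ + ℓ + e₂` covering the middle,
`h̄` of degree `q`; `p + e₁ = a`, `e₂ + q = b`): the row at `(y₁, y₂)` is
`([y₁|_{<p}] h · [y₂|_{≥e₂}] h̄) •` the `bodyMat` row of `g` at the overhangs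
`(y₁|_{≥p}, y₂|_{<e₂})` (pattern of `NcUnbalancedRank.outerFlat_framed_row₂`).
[cite: LagardeLimayeSrinivasan2018, §4 Theorem 17] -/
theorem ivFlat_row_cover {a ℓ b d p e₁ e₂ q : ℕ} (h1 : p + e₁ = a) (h2 : e₂ + q = b)
    (hd : a + ℓ + b = d) {h g hb : FreeAlgebra K σ} (hh : degPart d p h = h)
    (hg : degPart d (e₁ + ℓ + e₂) g = g) (hhb : degPart d q hb = hb)
    (y : (Fin a → σ) × (Fin b → σ)) :
    ivFlat K a ℓ b (h * g * hb) y =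
      (coeff ((List.ofFn y.1).take p) h * coeff ((List.ofFn y.2).drop e₂) hb) •
        bodyMat K ℓ e₂ e₁ g
          (fun i => y.1 (Fin.castLE h1.le (Fin.natAdd p i)),
            fun i => y.2 (Fin.castLE h2.le (Fin.castAdd q i))) := by
  funext A
  have hX := List.length_ofFn (f := y.1); have hY := List.length_ofFn (f := A)
  rw [Pi.smul_apply, smul_eq_mul, ivFlat_apply, coeff_three_cut K (d := d) (by omega) _
      (by simp only [List.length_append, List.length_ofFn]; omega) hh hg hhb,
    (take_drop₃_left (n := p) (Y := List.ofFn A) (Z := List.ofFn y.2) hX (by omega)).1,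
    (take_drop₃_left (n := p) (Y := List.ofFn A) (Z := List.ofFn y.2) hX (by omega)).2,
    (take_drop₃_right (n := e₁ + ℓ + e₂) (Z := List.ofFn y.2)
      (show ((List.ofFn y.1).drop p).length = e₁ by rw [List.length_drop, hX]; omega) hY
      (by omega)).1,
    (take_drop₃_right (n := p + (e₁ + ℓ + e₂)) (Z := List.ofFn y.2) hX hY (by omega)).2]
  simp only [bodyMat, ofFn_natAdd_drop h1 y.1, ofFn_castAdd_take h2 y.2,
    show e₁ + ℓ + e₂ - (e₁ + ℓ) = e₂ by omega, show p + (e₁ + ℓ + e₂) - (a + ℓ) = e₂ by omega]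
  ring

/-- INSIDE row formula (`h` of degree `a + e`, body `g` of degree `m` inside the middle,
`h̄` of degree `e' + b`; `e + m + e' = ℓ`). [cite: LagardeLimayeSrinivasan2018, §4 Theorem 17] -/
theorem ivFlat_row_inside {a ℓ b d e m e' : ℕ} (hℓ : e + m + e' = ℓ) (hd : a + ℓ + b = d)
    {h g hb : FreeAlgebra K σ} (hh : degPart d (a + e) h = h) (hg : degPart d m g = g)
    (hhb : degPart d (e' + b) hb = hb) (y : (Fin a → σ) × (Fin b → σ)) (A : Fin ℓ → σ) :
    ivFlat K a ℓ b (h * g * hb) y A =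
      coeff (List.ofFn y.1 ++ (List.ofFn A).take e) h *
        coeff (((List.ofFn A).drop e).take m) g *
        coeff ((List.ofFn A).drop (e + m) ++ List.ofFn y.2) hb := by
  have hX := List.length_ofFn (f := y.1); have hY := List.length_ofFn (f := A)
  rw [ivFlat_apply, coeff_three_cut K (d := d) (by omega) _
      (by simp only [List.length_append, List.length_ofFn]; omega) hh hg hhb,
    (take_drop₃_mid (n := a + e) (Z := List.ofFn y.2) hX hY (by omega) (by omega)).1,
    (take_drop₃_mid (n := a + e) (Z := List.ofFn y.2) hX hY (by omega) (by omega)).2,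
    Nat.add_sub_cancel_left,
    List.take_append_of_le_length (l₁ := (List.ofFn A).drop e)
      (by rw [List.length_drop, hY]; omega),
    (take_drop₃_mid (n := a + e + m) (Z := List.ofFn y.2) hX hY (by omega) (by omega)).2,
    show a + e + m - a = e + m by omega]

/-- OUTSIDE-RIGHT column formula (`h` of degree `a + ℓ + e`, body `g` of degree `m` inside the
right context, `h̄` of degree `q`; `e + m + q = b`). [cite: LagardeLimayeSrinivasan2018, §4] -/
theorem ivFlat_col_outside {a ℓ b d e m q : ℕ} (hb' : e + m + q = b) (hd : a + ℓ + b = d)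
    {h g hb : FreeAlgebra K σ} (hh : degPart d (a + ℓ + e) h = h) (hg : degPart d m g = g)
    (hhb : degPart d q hb = hb) (y : (Fin a → σ) × (Fin b → σ)) (A : Fin ℓ → σ) :
    ivFlat K a ℓ b (h * g * hb) y A =
      coeff (List.ofFn y.1 ++ List.ofFn A ++ (List.ofFn y.2).take e) h *
        coeff (((List.ofFn y.2).drop e).take m) g * coeff ((List.ofFn y.2).drop (e + m)) hb := by
  have hX := List.length_ofFn (f := y.1); have hY := List.length_ofFn (f := A)
  rw [ivFlat_apply, coeff_three_cut K (d := d) (by omega) _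
      (by simp only [List.length_append, List.length_ofFn]; omega) hh hg hhb,
    (take_drop₃_right (n := a + ℓ + e) (Z := List.ofFn y.2) hX hY (by omega)).1,
    (take_drop₃_right (n := a + ℓ + e) (Z := List.ofFn y.2) hX hY (by omega)).2,
    (take_drop₃_right (n := a + ℓ + e + m) (Z := List.ofFn y.2) hX hY (by omega)).2,
    Nat.add_sub_cancel_left, show a + ℓ + e + m - (a + ℓ) = e + m by omega]

/-- INSIDE dictionary row: indicator (`A` starts with `u`, and ends — from position `e + m` on —
with `u'`) times the coefficient in `g` of the middle `m` letters of `A`.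
[cite: LagardeLimayeSrinivasan2018, §4 Theorem 17] -/
def insRow (ℓ m e e' : ℕ) (g : FreeAlgebra K σ) (u : (Fin e → σ) × (Fin e' → σ))
    (A : Fin ℓ → σ) : K :=
  if (List.ofFn A).take e = List.ofFn u.1 ∧ (List.ofFn A).drop (e + m) = List.ofFn u.2 then
    coeff (((List.ofFn A).drop e).take m) g else 0

/-- OUTSIDE-RIGHT dictionary column: indicator (`y₁ = v₀`, `y₂` starts with `v`, and ends —
from position `e + m` on — with `v'`) times the coefficient in `g` of the `m` letters of `y₂`
from position `e`. [cite: LagardeLimayeSrinivasan2018, §4 Theorem 17] -/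
def outCol (a b m e q : ℕ) (g : FreeAlgebra K σ) (v : (Fin a → σ) × ((Fin e → σ) × (Fin q → σ)))
    (y : (Fin a → σ) × (Fin b → σ)) : K :=
  if List.ofFn y.1 = List.ofFn v.1 ∧ (List.ofFn y.2).take e = List.ofFn v.2.1 ∧
      (List.ofFn y.2).drop (e + m) = List.ofFn v.2.2 then
    coeff (((List.ofFn y.2).drop e).take m) g else 0

variable [Fintype σ]

/-- **R3 (COVER accounting)**: frames whose block covers the middle `[a, a+ℓ)`; rows lie in the
span of `|vals| · (m-ℓ+1) · N^{m-ℓ}` overhang rows. Serves the rotation-UPT rung (MODEL: rotUPT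
= rotation-UPT NORMAL FORM: circuits typed by a shape T in which every product gate multiplies
an operand typed by its left child and one typed by its right child IN EITHER ORDER (GateRot =
LLS18 Prop 7 typing + the rotated product); the conversion of an arbitrary rotUPT circuit (LLS18
§4: all parse trees rotations of one tree) to this normal form (gate duplication per node, poly
blow-up) is NOT formalised). [cite: LagardeLimayeSrinivasan2018, §4 Theorem 17] -/
theorem rank_ivFlat_cover_le {a ℓ b d m : ℕ} (hd : a + ℓ + b = d) (hℓm : ℓ ≤ m)
    (vals : List (FreeAlgebra K σ)) {B : Set (FreeAlgebra K σ)}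
    (hBv : ∀ g ∈ B, ∃ j, j < vals.length ∧ g = vals.getD j 0)
    (hB : ∀ g ∈ B, degPart d m g = g) {F : Finset (ℕ × ℕ)}
    (hF : ∀ p ∈ F, p.1 ≤ a ∧ p.2 ≤ b ∧ p.1 + m + p.2 = d) {f : FreeAlgebra K σ}
    (hf : f ∈ rotSpan B d F) :
    (ivFlat K a ℓ b f).rank ≤ vals.length * ((m - ℓ + 1) * Fintype.card σ ^ (m - ℓ)) := by
  classical
  let Φ : Fin vals.length × ((e : Fin (m - ℓ + 1)) × ((Fin e.val → σ) × (Fin (m - ℓ - e.val) → σ)))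
      → (Fin ℓ → σ) → K :=
    fun i => bodyMat K ℓ (m - ℓ - i.2.1.val) i.2.1.val (vals.getD i.1.val 0) i.2.2
  have h := rank_le_of_rotSpan K (ivFlat K a ℓ b) Φ (fun p hp g hg h hb hh hhb y => ?_) hf
  · rwa [Fintype.card_prod, Fintype.card_fin, card_sigma_dict] at h
  obtain ⟨h1, h2, hp⟩ := hF p hp
  obtain ⟨j, hj, rfl⟩ := hBv g hg
  rw [ivFlat_row_cover K (p := p.1) (e₁ := a - p.1) (e₂ := m - ℓ - (a - p.1)) (q := p.2)
    (by omega) (by omega) hd hh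
    (by rw [show a - p.1 + ℓ + (m - ℓ - (a - p.1)) = m by omega]; exact hB _ hg) hhb y]
  exact Submodule.smul_mem _ _ (Submodule.subset_span ⟨⟨⟨j, hj⟩, ⟨a - p.1, by omega⟩, _⟩, rfl⟩)

/-- **R2 (INSIDE accounting)**: frames whose block lies inside the middle; rows lie in the span
of `|vals| · (ℓ-m+1) · N^{ℓ-m}` indicator-times-body rows `insRow`. Serves the rotation-UPT rung
(MODEL: rotUPT = rotation-UPT NORMAL FORM: circuits typed by a shape T in which every product
gate multiplies an operand typed by its left child and one typed by its right child IN EITHER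
ORDER (GateRot = LLS18 Prop 7 typing + the rotated product); the conversion of an arbitrary
rotUPT circuit (LLS18 §4: all parse trees rotations of one tree) to this normal form (gate
duplication per node, poly blow-up) is NOT formalised).
[cite: LagardeLimayeSrinivasan2018, §4 Theorem 17] -/
theorem rank_ivFlat_inside_le {a ℓ b d m : ℕ} (hd : a + ℓ + b = d) (hmℓ : m ≤ ℓ)
    (vals : List (FreeAlgebra K σ)) {B : Set (FreeAlgebra K σ)}
    (hBv : ∀ g ∈ B, ∃ j, j < vals.length ∧ g = vals.getD j 0)
    (hB : ∀ g ∈ B, degPart d m g = g) {F : Finset (ℕ × ℕ)}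
    (hF : ∀ p ∈ F, a ≤ p.1 ∧ p.1 + m ≤ a + ℓ ∧ p.1 + m + p.2 = d) {f : FreeAlgebra K σ}
    (hf : f ∈ rotSpan B d F) :
    (ivFlat K a ℓ b f).rank ≤ vals.length * ((ℓ - m + 1) * Fintype.card σ ^ (ℓ - m)) := by
  classical
  let Φ : Fin vals.length × ((e : Fin (ℓ - m + 1)) × ((Fin e.val → σ) × (Fin (ℓ - m - e.val) → σ)))
      → (Fin ℓ → σ) → K :=
    fun i => insRow K ℓ m i.2.1.val (ℓ - m - i.2.1.val) (vals.getD i.1.val 0) i.2.2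
  have h := rank_le_of_rotSpan K (ivFlat K a ℓ b) Φ (fun p hp g hg h hb hh hhb y => ?_) hf
  · rwa [Fintype.card_prod, Fintype.card_fin, card_sigma_dict] at h
  obtain ⟨h1, h2, hp⟩ := hF p hp
  obtain ⟨j, hj, rfl⟩ := hBv g hg
  have he : p.1 - a + m + (ℓ - m - (p.1 - a)) = ℓ := by omega
  have hle : p.1 - a ≤ ℓ := by omega
  have hrow : ivFlat K a ℓ b (h * vals.getD j 0 * hb) y =
      ∑ u : (Fin (p.1 - a) → σ) × (Fin (ℓ - m - (p.1 - a)) → σ),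
        (coeff (List.ofFn y.1 ++ List.ofFn u.1) h * coeff (List.ofFn u.2 ++ List.ofFn y.2) hb) •
          insRow K ℓ m (p.1 - a) (ℓ - m - (p.1 - a)) (vals.getD j 0) u := by
    funext A
    rw [ivFlat_row_inside K he hd (by rw [show a + (p.1 - a) = p.1 by omega]; exact hh)
        (hB _ hg) (by rw [show ℓ - m - (p.1 - a) + b = p.2 by omega]; exact hhb) y A,
      Finset.sum_apply, Finset.sum_eq_single (fun i => A (Fin.castLE hle i),
        fun i => A (Fin.castLE he.le (Fin.natAdd (p.1 - a + m) i)))]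
    · simp only [Pi.smul_apply, smul_eq_mul, insRow, ofFn_castLE_take, ofFn_natAdd_drop he A,
        and_self, ite_true]
      ring
    · intro u _ hu
      simp only [Pi.smul_apply, smul_eq_mul, insRow]
      rw [if_neg, mul_zero]
      rintro ⟨e1, e2⟩
      exact hu (Prod.ext (List.ofFn_injective (e1.symm.trans (ofFn_castLE_take hle A).symm))
        (List.ofFn_injective (e2.symm.trans (ofFn_natAdd_drop he A).symm)))
    · exact fun hu => absurd (Finset.mem_univ _) hu
  rw [hrow]
  exact sum_mem fun u _ => Submodule.smul_mem _ _
    (Submodule.subset_span ⟨⟨⟨j, hj⟩, ⟨p.1 - a, by omega⟩, u⟩, rfl⟩)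

/-- **R1 (OUTSIDE accounting)**: frames whose block lies inside the right context `[a+ℓ, d)`;
columns lie in the span of `|vals| · N^a · (b-m+1) · N^{b-m}` indicator-times-body columns
`outCol`. Serves the rotation-UPT rung (MODEL: rotUPT = rotation-UPT NORMAL FORM: circuits typed
by a shape T in which every product gate multiplies an operand typed by its left child and one
typed by its right child IN EITHER ORDER (GateRot = LLS18 Prop 7 typing + the rotated product);
the conversion of an arbitrary rotUPT circuit (LLS18 §4: all parse trees rotations of one tree)
to this normal form (gate duplication per node, poly blow-up) is NOT formalised).
[cite: LagardeLimayeSrinivasan2018, §4 Theorem 17] -/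
theorem rank_ivFlat_outside_le {a ℓ b d m : ℕ} (hd : a + ℓ + b = d) (hmb : m ≤ b)
    (vals : List (FreeAlgebra K σ)) {B : Set (FreeAlgebra K σ)}
    (hBv : ∀ g ∈ B, ∃ j, j < vals.length ∧ g = vals.getD j 0)
    (hB : ∀ g ∈ B, degPart d m g = g) {F : Finset (ℕ × ℕ)}
    (hF : ∀ p ∈ F, a + ℓ ≤ p.1 ∧ p.1 + m + p.2 = d) {f : FreeAlgebra K σ}
    (hf : f ∈ rotSpan B d F) :
    (ivFlat K a ℓ b f).rank ≤
      vals.length * (Fintype.card σ ^ a * ((b - m + 1) * Fintype.card σ ^ (b - m))) := by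
  classical
  let Φ : Fin vals.length × ((Fin a → σ) × ((e : Fin (b - m + 1)) ×
      ((Fin e.val → σ) × (Fin (b - m - e.val) → σ)))) → (Fin a → σ) × (Fin b → σ) → K :=
    fun i => outCol K a b m i.2.2.1.val (b - m - i.2.2.1.val) (vals.getD i.1.val 0) (i.2.1, i.2.2.2)
  have h := rank_le_of_rotSpan K
    ((Matrix.transposeLinearEquiv _ _ K K).toLinearMap ∘ₗ ivFlat K a ℓ b) Φ
    (fun p hp g hg h hb hh hhb A => ?_) hf
  · rw [Fintype.card_prod, Fintype.card_fin, Fintype.card_prod, Fintype.card_fun,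
      Fintype.card_fin, card_sigma_dict] at h
    rw [← Matrix.rank_transpose]
    exact h
  obtain ⟨h1, hp⟩ := hF p hp
  obtain ⟨j, hj, rfl⟩ := hBv g hg
  have he : p.1 - (a + ℓ) + m + (b - m - (p.1 - (a + ℓ))) = b := by omega
  have hle : p.1 - (a + ℓ) ≤ b := by omega
  have hcol : (fun y => ivFlat K a ℓ b (h * vals.getD j 0 * hb) y A) =
      ∑ v : (Fin a → σ) × ((Fin (p.1 - (a + ℓ)) → σ) × (Fin (b - m - (p.1 - (a + ℓ))) → σ)),
        (coeff (List.ofFn v.1 ++ List.ofFn A ++ List.ofFn v.2.1) h *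
            coeff (List.ofFn v.2.2) hb) •
          outCol K a b m (p.1 - (a + ℓ)) (b - m - (p.1 - (a + ℓ))) (vals.getD j 0) v := by
    funext y
    rw [ivFlat_col_outside K he hd (by rw [show a + ℓ + (p.1 - (a + ℓ)) = p.1 by omega]; exact hh)
        (hB _ hg) (by rw [show b - m - (p.1 - (a + ℓ)) = p.2 by omega]; exact hhb) y A,
      Finset.sum_apply, Finset.sum_eq_single (y.1, (fun i => y.2 (Fin.castLE hle i),
        fun i => y.2 (Fin.castLE he.le (Fin.natAdd (p.1 - (a + ℓ) + m) i))))]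
    · simp only [Pi.smul_apply, smul_eq_mul, outCol, ofFn_castLE_take, ofFn_natAdd_drop he y.2,
        and_self, ite_true]
      ring
    · intro v _ hv
      simp only [Pi.smul_apply, smul_eq_mul, outCol]
      rw [if_neg, mul_zero]
      rintro ⟨e0, e1, e2⟩
      exact hv (Prod.ext (List.ofFn_injective e0.symm) (Prod.ext
        (List.ofFn_injective (e1.symm.trans (ofFn_castLE_take hle y.2).symm))
        (List.ofFn_injective (e2.symm.trans (ofFn_natAdd_drop he y.2).symm))))
    · exact fun hv => absurd (Finset.mem_univ _) hv
  show (fun y => ivFlat K a ℓ b (h * vals.getD j 0 * hb) y A) ∈ _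
  rw [hcol]
  exact sum_mem fun v _ => Submodule.smul_mem _ _
    (Submodule.subset_span ⟨⟨⟨j, hj⟩, v.1, ⟨p.1 - (a + ℓ), by omega⟩, v.2⟩, rfl⟩)

end Flat

end Summit.ValiantsHypothesis.ValiantsHypothesis.Theorems.NcRotParseTreeRank

end
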